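import Summits.BirchSwinnertonDyer.BirchSwinnertonDyer.Theses.PAdicOrderV2
import Literature.NumberTheory.EllipticCurves.BSDAnalyticRankTunnellCMProofs

/-!
# `PAdicOrderThesisR2` (crux stmt-BirchSwinnertonDyer-0487, route `PAdicOrderV2`):
# the conjunct `IsOrdinaryAt W p` is load-bearing — asked at EVERY good prime `p ≥ 5` the thesis
# is FALSE (negative-side support, refuter crux-disprover seat; this file does NOT refute the crux)

The crux X says: every elliptic `E/ℚ` (globally minimal `W`) has SOME good ORDINARY prime `p` and a
newform `f` with `ord_T L_p(f, α_p, T) = r_an(E)` and `= r_MW(E)`, where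
`L_p = Literature.NumberTheory.EllipticCurves.padicLFunction f (unitRoot W p)` is the
Mazur–Swinnerton-Dyer / Mazur–Tate–Teitelbaum unit-root `p`-adic `L`-function of the tree.

Recorded here, sorry-free:

* `padicLFunction_zero` — for every cusp form `f` and every prime `p`, `L_p(f, 0, T) = 0`: at the
  root `α = 0` the MSD measure vanishes at every positive level (`α⁻ⁿ = 0⁻ⁿ = 0`), so every Riemann
  sum, every coefficient, and the series are `0` (Mazur–Tate–Teitelbaum 1986 §I.10–I.13 define
  `μ_{f,α}` only for an allowable root `α ≠ 0`; `0` is the tree's junk value).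
* `unitRoot_eq_zero_of_dvd` — if `p ∣ a_p(W)` (every supersingular prime, every additive prime)
  then `X² - a_p X + p` has no unit root in `ℤ_p` (reduce mod `p`: `ᾱ² = 0`), so the tree's
  `unitRoot W p` takes its junk value `0`; hence `order_padicLFunction_eq_top_of_dvd`:
  `ord_T L_p(E, T) = ⊤` there, equal to no natural number (`order_ne_natCast_of_dvd`).
* `padicOrderThesisR2_false_at_every_good_prime` — the strengthening of X in which
  "∃ good ordinary `p`" is replaced by "∀ good `p ≥ 5`" (stated inline; no proposition is defined
  under `Summits/`) is FALSE: witness the congruent number curve `E_1 : y² = x³ - x` (globally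
  minimal, tree theorem `isGloballyMinimal_congruentNumberCurve`) at its good supersingular prime
  `p = 7` (`a_7 = 0`, Ireland–Rosen Ch. 18 §4 Thm 5, tree theorem
  `frobeniusTrace_congruentNumberCurveInt`). No modularity is needed: the `∃ f` is never reached.
  The same witness kills the comparison-only form (`comparison_false_at_every_good_prime`) and the
  upper-bound form `ord ≤ r_an` (`orderLE_false_at_every_good_prime`) — the witness prime of the
  line-`Sketch` stub `stub_UB_pos` can never be a prime dividing `a_p`.

Moral for provers: X (and cruxes #2, #3, and `stub_UB_pos`) may only ever be evaluated at an
ORDINARY prime — not merely for Kato's theorem or the control theorem, but because the tree's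
`L_p` is the zero series off the ordinary locus. A line through supersingular primes needs the
signed `L_p^±` (Pollack 2003 / Kobayashi 2003), which the tree does not have, and a restated crux.
-/

noncomputable section

-- single-conjunct summit: `Summit.BirchSwinnertonDyer.BirchSwinnertonDyer.…` repeats the name by design
set_option linter.dupNamespace false

namespace Summit.BirchSwinnertonDyer.BirchSwinnertonDyer.Theorems.PAdicOrderThesisR2.Negative

open Literature.NumberTheory.EllipticCurves Literature.NumberTheory.EllipticCurves.ModularForms
open scoped MatrixGroups ModularForm
open CongruenceSubgroup Filter Topology

/-! ## The junk root `α = 0` of the Mazur–Swinnerton-Dyer construction -/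

section JunkRoot

variable {N : ℕ} (f : CuspForm (Gamma0 N) 2) {p : ℕ} [Fact p.Prime]

/-- At the root `α = 0` every value of the MSD measure `μ_{f,α}(a + p^m ℤ_p)` at positive level
`m` vanishes: it is `α⁻ᵐ [a/pᵐ]⁺ - α⁻ᵐ⁻¹ [a/pᵐ⁻¹]⁺` with `0⁻¹ = 0`
(Mazur–Tate–Teitelbaum 1986, §I.10 (10.1), read at the tree's junk root).
[cite: MazurTateTeitelbaum1986Invent, §I.10 (10.1)] -/
theorem msdMeasure_zero_of_pos {m : ℕ} (hm : 0 < m) (a : ZMod (p ^ m)) :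
    msdMeasure f (0 : ℚ_[p]) m a = 0 := by
  obtain ⟨m, rfl⟩ := Nat.exists_eq_add_one_of_ne_zero hm.ne'
  simp [msdMeasure]

omit [Fact p.Prime] in
/-- The cyclotomic exponent `e₀` (`Γ = 1 + p^{e₀} ℤ_p`) is positive: `e₀ = 2` for `p = 2`, else `1`
(Mazur–Tate–Teitelbaum 1986, §I.13). [cite: MazurTateTeitelbaum1986Invent, §I.13] -/
theorem cyclotomicExponent_pos : 0 < cyclotomicExponent p := by
  unfold cyclotomicExponent
  split <;> omega

/-- At `α = 0` every Riemann sum of every coefficient of `L_p(f, α, T)` is `0` (all the measure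
values entering it are taken at level `n + e₀ ≥ 1`). [folklore] -/
theorem padicLRiemannSum_zero (k n : ℕ) : padicLRiemannSum f (0 : ℚ_[p]) k n = 0 := by
  unfold padicLRiemannSum
  simp only [msdMeasure_zero_of_pos f (Nat.add_pos_right n cyclotomicExponent_pos), zero_mul,
    Finset.sum_const_zero, finsum_zero]

/-- At `α = 0` every coefficient `∫ (ℓ(x) choose k) dμ_{f,0}` of `L_p(f, α, T)` is `0`: it is the
limit (`limUnder atTop`, `ℚ_p` Hausdorff) of the identically zero sequence of Riemann sums.
[folklore] -/
theorem padicLCoeff_zero (k : ℕ) : padicLCoeff f (0 : ℚ_[p]) k = 0 := by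
  unfold padicLCoeff
  have h : padicLRiemannSum f (0 : ℚ_[p]) k = fun _ => 0 := funext (padicLRiemannSum_zero f k)
  rw [h]
  exact tendsto_const_nhds.limUnder_eq

/-- **`L_p(f, 0, T) = 0`.** At the junk root `α = 0` the tree's `p`-adic `L`-function
`padicLFunction f 0 ∈ ℚ_p⟦T⟧` is the zero power series, for every cusp form `f ∈ S_2(Γ₀(N))` and
every prime `p` (Mazur–Tate–Teitelbaum 1986, §I.11: the construction is only meant for an
allowable root `α ≠ 0`). [cite: MazurTateTeitelbaum1986Invent, §I.11 (allowable root)] -/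
theorem padicLFunction_zero : padicLFunction f (0 : ℚ_[p]) = 0 := by
  ext k
  simp [padicLCoeff_zero]

end JunkRoot

/-! ## No unit root at a prime dividing `a_p` -/

section NoUnitRoot

variable (W : WeierstrassCurve ℚ) [W.IsGloballyMinimal] (p : ℕ) [Fact p.Prime]

/-- If `p ∣ a_p(W)` then no root `α ∈ ℤ_p` of the Hecke polynomial `X² - a_p X + p` is a unit:
reducing modulo `p` gives `ᾱ² = 0` in `𝔽_p`, so `ᾱ = 0`, while a unit reduces to a unit. This is
the supersingular (and additive) case excluded from the unit-root construction
(Mazur–Tate–Teitelbaum 1986, §I.11; Silverman AEC V, Ex. 5.10(a): supersingular iff `a_p ≡ 0`).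
[cite: MazurTateTeitelbaum1986Invent, §I.11 (allowable root)] -/
theorem not_isUnit_root_of_dvd (h : (p : ℤ) ∣ W.frobeniusTrace p) {α : ℤ_[p]}
    (hα : α ^ 2 - (W.frobeniusTrace p : ℤ_[p]) * α + p = 0) : ¬ IsUnit α := by
  intro hu
  have hap : PadicInt.toZMod (W.frobeniusTrace p : ℤ_[p]) = 0 := by
    rw [map_intCast, ZMod.intCast_zmod_eq_zero_iff_dvd]
    exact h
  have hp0 : PadicInt.toZMod (p : ℤ_[p]) = 0 := by
    rw [map_natCast, ZMod.natCast_self]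
  have h2 := congrArg (PadicInt.toZMod (p := p)) hα
  rw [map_add, map_sub, map_mul, map_pow, hap, hp0, zero_mul, sub_zero, add_zero, map_zero] at h2
  exact (hu.map PadicInt.toZMod).ne_zero ((pow_eq_zero_iff two_ne_zero).mp h2)

/-- **`unitRoot W p = 0` whenever `p ∣ a_p(W)`**: there is no (let alone a unique) unit root, so
the tree's `unitRoot` takes its `dif_neg` junk value `0` — in particular at every supersingular
prime of `W` (Mazur–Tate–Teitelbaum 1986, §I.11). [cite: MazurTateTeitelbaum1986Invent, §I.11 (allowable root)] -/
theorem unitRoot_eq_zero_of_dvd (h : (p : ℤ) ∣ W.frobeniusTrace p) : unitRoot W p = 0 := by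
  classical
  unfold unitRoot
  rw [dif_neg]
  rintro ⟨α, ⟨hα, hu⟩, -⟩
  exact not_isUnit_root_of_dvd W p h hα hu

/-- Hence the tree's `L_p(E, T) = padicLFunction f (unitRoot W p)` is the ZERO series at every
prime `p ∣ a_p(W)`, for every cusp form `f`. [folklore] -/
theorem padicLFunction_unitRoot_eq_zero_of_dvd (h : (p : ℤ) ∣ W.frobeniusTrace p) {N : ℕ}
    (f : CuspForm (Gamma0 N) 2) : padicLFunction f (unitRoot W p : ℚ_[p]) = 0 := by
  rw [unitRoot_eq_zero_of_dvd W p h, PadicInt.coe_zero, padicLFunction_zero]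

/-- … so its `T`-adic order is `⊤` at every prime `p ∣ a_p(W)`. [folklore] -/
theorem order_padicLFunction_eq_top_of_dvd (h : (p : ℤ) ∣ W.frobeniusTrace p) {N : ℕ}
    (f : CuspForm (Gamma0 N) 2) : (padicLFunction f (unitRoot W p : ℚ_[p])).order = ⊤ := by
  rw [padicLFunction_unitRoot_eq_zero_of_dvd W p h f, PowerSeries.order_zero]

/-- … and therefore equals no natural number: neither `ord = r_an` nor `ord = r_MW` of the crux is
obtainable at a prime dividing `a_p`. [folklore] -/
theorem order_ne_natCast_of_dvd (h : (p : ℤ) ∣ W.frobeniusTrace p) {N : ℕ}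
    (f : CuspForm (Gamma0 N) 2) (r : ℕ) :
    (padicLFunction f (unitRoot W p : ℚ_[p])).order ≠ (r : ℕ∞) := by
  rw [order_padicLFunction_eq_top_of_dvd W p h f]
  exact ENat.top_ne_coe _

/-- … nor the upper bound `ord ≤ r` for any natural `r` (the shape of the line-`Sketch` stub
`stub_UB_pos`, whose witness prime therefore cannot divide `a_p`). [folklore] -/
theorem not_order_le_natCast_of_dvd (h : (p : ℤ) ∣ W.frobeniusTrace p) {N : ℕ}
    (f : CuspForm (Gamma0 N) 2) (r : ℕ) :
    ¬ (padicLFunction f (unitRoot W p : ℚ_[p])).order ≤ (r : ℕ∞) := by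
  rw [order_padicLFunction_eq_top_of_dvd W p h f, top_le_iff]
  exact ENat.coe_ne_top _

/-- Dually, the Kato-side lower bound `r ≤ ord` holds VACUOUSLY at a prime dividing `a_p`
(`ord = ⊤`): it carries no information there. [folklore] -/
theorem natCast_le_order_of_dvd (h : (p : ℤ) ∣ W.frobeniusTrace p) {N : ℕ}
    (f : CuspForm (Gamma0 N) 2) (r : ℕ) :
    (r : ℕ∞) ≤ (padicLFunction f (unitRoot W p : ℚ_[p])).order := by
  rw [order_padicLFunction_eq_top_of_dvd W p h f]
  exact le_top

end NoUnitRoot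

/-! ## The witness `E_1 : y² = x³ - x` at `p = 7`, and the refuted strengthenings -/

section Witness

/-- `a_7(E_1) = 0` for the congruent number curve `E_1 : y² = x³ - x` (`7 ≡ 3 mod 4`, `7 ∤ 1`:
Ireland–Rosen Ch. 18 §4 Thm 5, the tree's `frobeniusTrace_congruentNumberCurveInt`), hence
`7 ∣ a_7(E_1)`: `7` is a good supersingular prime of `E_1`.
[cite: IrelandRosen1990, Ch. 18 §4, Theorem 5 (PDF p. 301), first assertion] -/
theorem seven_dvd_frobeniusTrace_congruentNumberCurve_one
    [(congruentNumberCurve 1).IsGloballyMinimal] :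
    ((7 : ℕ) : ℤ) ∣ (congruentNumberCurve 1).frobeniusTrace 7 := by
  rw [frobeniusTrace_congruentNumberCurve 1 7,
    frobeniusTrace_congruentNumberCurveInt (by norm_num) (by norm_num) (by norm_num)]
  exact dvd_zero _

/-- **The thesis asked at EVERY good prime `p ≥ 5` is false.** Replacing "∃ good ordinary `p`" in
`PAdicOrderThesisR2` by "∀ good `p ≥ 5`" (the statement below, inline) fails at the globally
minimal elliptic curve `E_1 : y² = x³ - x` and its good supersingular prime `p = 7`: there the
tree's unit-root `p`-adic `L`-function is the zero series (`order_ne_natCast_of_dvd`), for every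
candidate newform `f`. So the `IsOrdinaryAt` conjunct of the crux is load-bearing.
[cite: MazurTateTeitelbaum1986Invent, §I.11 (allowable root)] -/
theorem padicOrderThesisR2_false_at_every_good_prime :
    ¬ (∀ (W : WeierstrassCurve ℚ) [W.IsElliptic] [W.IsGloballyMinimal] (p : ℕ) [Fact p.Prime],
        5 ≤ p → W.HasGoodReductionAtPrime p →
          ∃ (N : ℕ) (_ : NeZero N) (f : CuspForm (Gamma0 N) 2), IsNewformOf W f ∧
            (padicLFunction f (unitRoot W p : ℚ_[p])).order = W.analyticRank ∧
            (padicLFunction f (unitRoot W p : ℚ_[p])).order = W.mordellWeilRank) := by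
  intro h
  haveI : (congruentNumberCurve 1).IsElliptic := isElliptic_congruentNumberCurve one_ne_zero
  haveI : (congruentNumberCurve 1).IsGloballyMinimal :=
    isGloballyMinimal_congruentNumberCurve squarefree_one
  haveI : Fact (Nat.Prime 7) := ⟨by norm_num⟩
  obtain ⟨N, _, f, -, han, -⟩ := h (congruentNumberCurve 1) 7 (by norm_num)
    (hasGoodReductionAtPrime_congruentNumberCurve (by norm_num))
  exact order_ne_natCast_of_dvd _ 7 seven_dvd_frobeniusTrace_congruentNumberCurve_one f _ han

/-- **The comparison `ord_T L_p = r_an` asked at EVERY good prime `p ≥ 5` is false** (the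
`∃f`-packaged all-good-primes form of crux #2 `PAdicOrderComparisonR2`'s equality): same witness
`(E_1, 7)`. [cite: MazurTateTeitelbaum1986Invent, §I.11 (allowable root)] -/
theorem comparison_false_at_every_good_prime :
    ¬ (∀ (W : WeierstrassCurve ℚ) [W.IsElliptic] [W.IsGloballyMinimal] (p : ℕ) [Fact p.Prime],
        5 ≤ p → W.HasGoodReductionAtPrime p →
          ∃ (N : ℕ) (_ : NeZero N) (f : CuspForm (Gamma0 N) 2), IsNewformOf W f ∧
            (padicLFunction f (unitRoot W p : ℚ_[p])).order = W.analyticRank) := by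
  intro h
  haveI : (congruentNumberCurve 1).IsElliptic := isElliptic_congruentNumberCurve one_ne_zero
  haveI : (congruentNumberCurve 1).IsGloballyMinimal :=
    isGloballyMinimal_congruentNumberCurve squarefree_one
  haveI : Fact (Nat.Prime 7) := ⟨by norm_num⟩
  obtain ⟨N, _, f, -, han⟩ := h (congruentNumberCurve 1) 7 (by norm_num)
    (hasGoodReductionAtPrime_congruentNumberCurve (by norm_num))
  exact order_ne_natCast_of_dvd _ 7 seven_dvd_frobeniusTrace_congruentNumberCurve_one f _ han

/-- **The upper bound `ord_T L_p ≤ r_an` asked at EVERY good prime `p ≥ 5` is false** (the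
all-good-primes form of the witness clause of the line-`Sketch` stub `stub_UB_pos`): same witness
`(E_1, 7)`. [cite: MazurTateTeitelbaum1986Invent, §I.11 (allowable root)] -/
theorem orderLE_false_at_every_good_prime :
    ¬ (∀ (W : WeierstrassCurve ℚ) [W.IsElliptic] [W.IsGloballyMinimal] (p : ℕ) [Fact p.Prime],
        5 ≤ p → W.HasGoodReductionAtPrime p →
          ∃ (N : ℕ) (_ : NeZero N) (f : CuspForm (Gamma0 N) 2), IsNewformOf W f ∧
            (padicLFunction f (unitRoot W p : ℚ_[p])).order ≤ (W.analyticRank : ℕ∞)) := by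
  intro h
  haveI : (congruentNumberCurve 1).IsElliptic := isElliptic_congruentNumberCurve one_ne_zero
  haveI : (congruentNumberCurve 1).IsGloballyMinimal :=
    isGloballyMinimal_congruentNumberCurve squarefree_one
  haveI : Fact (Nat.Prime 7) := ⟨by norm_num⟩
  obtain ⟨N, _, f, -, han⟩ := h (congruentNumberCurve 1) 7 (by norm_num)
    (hasGoodReductionAtPrime_congruentNumberCurve (by norm_num))
  exact not_order_le_natCast_of_dvd _ 7 seven_dvd_frobeniusTrace_congruentNumberCurve_one f _ han

end Witness

end Summit.BirchSwinnertonDyer.BirchSwinnertonDyer.Theorems.PAdicOrderThesisR2.Negative
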